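import Summits.Ventures.PercRepro.RankDistEarsPattern

/-!
# PercRepro — `C₄ + ears`: THE BOTTOM SETS AND THE UP-SET OF THE TIGHT LAYER (p9, gen 24)

With `K = Σ_j k j` ears in all, the tight layer of `C₄ + ears` (`RankDistEars`, `RankDistEarsPattern`) is
`(p, q) = (K + 3, K + 1)` (`#E = 4 + 2K`, rank `K + 3`). In pattern terms (`patX`, `patG`):
* `mem_Uq_ears` (THE BOTTOM SETS): `B` is a bottom set iff it has no full ear, at most one missed ear on each host,
  the hosts with a missed ear lie in `X_B`, and `#X_B = #{hosts with a missed ear} + 1 ≤ 3` (`BottomPat`) — from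
  the two rank equations `ρ(B) = K + 1`, `ρ(E ∖ B) = K + 3` and the rank formula on `B` and its complement;
* `exists_mem_Uq_subset_iff_ears` (THE UP-SET): `A` contains a bottom set iff it has at most one missed ear on each
  host, the hosts with a missed ear lie in `X_A`, `#X_A ≥ #{such hosts} + 1`, and there are at most two such hosts
  (`UpPat`); the bottom set inside `A` keeps one edge of every hit ear (`pick`) and `#M + 1` host edges.
Nothing here moves any window of the crux.
-/

namespace PercRepro.RankDist

open Set Finset _root_.Matroid PercRepro.ThmH

variable {k : Fin 4 → ℕ}

/-! ## The bottom sets -/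

variable (k)

/-- **The bottom pattern**: no full ear, at most one missed ear on each host, the hosts with a missed ear inside
`X`, and `#X = #{hosts with a missed ear} + 1 ≤ 3`. -/
def BottomPat (X : Finset (Fin 4)) (g : Ear k → Finset Bool) : Prop :=
  (∀ i, g i ≠ Finset.univ) ∧ (∀ j, hostMiss k g j ≤ 1) ∧ typeM (hostType k g) ⊆ X ∧
    X.card = (typeM (hostType k g)).card + 1 ∧ X.card ≤ 3

/-- The finset ground set of `C₄ + ears` is everything. -/
lemma gr_ears : gr (ears k) = Finset.univ := by
  apply Finset.coe_injective
  rw [coe_gr, ears_ground, Finset.coe_univ]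

variable {k}

/-- The complement of a finset, as a set. -/
lemma coe_gr_sdiff (B : Finset (Gr k)) : ((gr (ears k) \ B : Finset (Gr k)) : Set (Gr k)) = Set.univ \ (B : Set (Gr k)) := by
  rw [Finset.coe_sdiff, coe_gr, ears_ground]

/-- The full ears of a pattern without full ears: none. -/
lemma fullSet_eq_empty_iff (g : Ear k → Finset Bool) : fullSet k g = ∅ ↔ ∀ i, g i ≠ Finset.univ := by
  rw [fullSet, Finset.filter_eq_empty_iff]
  simp only [Finset.mem_univ, true_implies]

/-- At most one missed ear per host, from the injectivity of the host map on the missed ears. -/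
lemma hostMiss_le_one_of_card_image (g : Ear k → Finset Bool)
    (h : ((missSet k g).image Sigma.fst).card = (missSet k g).card) : ∀ j, hostMiss k g j ≤ 1 := by
  intro j
  rw [Finset.card_image_iff] at h
  unfold hostMiss
  apply Finset.card_le_one.2
  intro a ha b hb
  rw [Finset.mem_filter] at ha hb
  exact h (by rw [Finset.mem_coe, missSet, Finset.mem_filter]; exact ⟨Finset.mem_univ _, ha.2.2⟩)
    (by rw [Finset.mem_coe, missSet, Finset.mem_filter]; exact ⟨Finset.mem_univ _, hb.2.2⟩)
    (ha.2.1.trans hb.2.1.symm)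

/-- **THE BOTTOM SETS OF `C₄ + ears`** (tight layer `(K + 3, K + 1)`, `K = Σ_j k j`): `B` is a bottom set iff its
pattern is a bottom pattern. -/
theorem mem_Uq_ears (B : Finset (Gr k)) :
    B ∈ PerFlat.Uq (ears k) (∑ j, k j + 3) (∑ j, k j + 1) ↔ BottomPat k (patX k ↑B) (patG k ↑B) := by
  rw [PerFlat.mem_Uq, coe_gr_sdiff, gr_ears, eRk_eq_coe_rk (ears k) (A := (B : Set (Gr k)))
    (by rw [ears_ground]; exact Set.subset_univ _),
    eRk_eq_coe_rk (ears k) (A := Set.univ \ (B : Set (Gr k))) (by rw [ears_ground]; exact Set.subset_univ _),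
    ENat.coe_inj, ENat.coe_inj, rk_ears_pat, rk_ears_pat, patX_compl, and_iff_right (Finset.subset_univ _)]
  simp only [patG_compl, compl_ne_empty_iff, compl_eq_univ_iff]
  set X := patX k (B : Set (Gr k)) with hX
  set g := patG k (B : Set (Gr k)) with hg
  -- the counts
  have hK : (Finset.univ.filter (fun i => g i ≠ ∅)).card + (missSet k g).card = ∑ j, k j :=
    card_hit_add_card_miss g
  have hK' : (Finset.univ.filter (fun i => g i ≠ Finset.univ)).card + (fullSet k g).card = ∑ j, k j := by
    rw [fullSet, ← card_ear k, ← Finset.card_univ]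
    have := Finset.card_filter_add_card_filter_not (s := (Finset.univ : Finset (Ear k)))
      (fun i => g i = Finset.univ)
    rw [add_comm] at this
    simpa only [ne_eq] using this
  have hfull : Finset.univ.filter (fun i : Ear k => g i = Finset.univ) = fullSet k g := rfl
  have hmiss : Finset.univ.filter (fun i : Ear k => g i = ∅) = missSet k g := rfl
  rw [hfull, hmiss]
  have hXc : Xᶜ.card = 4 - X.card := by
    rw [Finset.card_compl, Fintype.card_fin]
  have hXle : X.card ≤ 4 := by
    have := Finset.card_le_univ X; rwa [Fintype.card_fin] at this
  -- the union in the complement's rank: `#(Xᶜ ∪ Y) = #Xᶜ + #(Y ∩ X)` for any `Y`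
  have hunion : ∀ Y : Finset (Fin 4), (Xᶜ ∪ Y).card = Xᶜ.card + (Y ∩ X).card := by
    intro Y
    rw [← Finset.card_union_of_disjoint (Finset.disjoint_left.2 (fun a ha hb => by
      rw [Finset.mem_compl] at ha; exact ha (Finset.mem_inter.1 hb).2))]
    congr 1
    ext a
    simp only [Finset.mem_union, Finset.mem_compl, Finset.mem_inter]
    tauto
  constructor
  · rintro ⟨h1, h2⟩
    -- no full ear
    have hFu : (fullSet k g).card = 0 := by
      have := Nat.min_le_right (Xᶜ ∪ (missSet k g).image Sigma.fst).card 3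
      omega
    have hfullE : fullSet k g = ∅ := Finset.card_eq_zero.1 hFu
    have hnofull : ∀ i, g i ≠ Finset.univ := (fullSet_eq_empty_iff g).1 hfullE
    rw [hfullE, Finset.image_empty, Finset.union_empty] at h1
    have hmin3 : min (Xᶜ ∪ (missSet k g).image Sigma.fst).card 3 = 3 := by omega
    have h3 : 3 ≤ (Xᶜ ∪ (missSet k g).image Sigma.fst).card := by
      by_contra hlt
      rw [min_eq_left (Nat.le_of_not_le hlt)] at hmin3
      omega
    rw [hunion, hXc] at h3
    have hinter_le : ((missSet k g).image Sigma.fst ∩ X).card ≤ ((missSet k g).image Sigma.fst).card :=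
      Finset.card_le_card Finset.inter_subset_left
    have himg_le := card_image_fst_missSet_le g
    have hminX : min X.card 3 = (missSet k g).card + 1 := by omega
    have hXcard : X.card = (missSet k g).card + 1 := by
      rcases Nat.lt_or_ge 3 X.card with h | h
      · rw [min_eq_right h.le] at hminX; omega
      · rw [min_eq_left h] at hminX; exact hminX
    have hX3 : X.card ≤ 3 := by omega
    have himg_eq : ((missSet k g).image Sigma.fst).card = (missSet k g).card := by omega
    have hle1 := hostMiss_le_one_of_card_image g himg_eq
    have hinter_eq : ((missSet k g).image Sigma.fst ∩ X).card = ((missSet k g).image Sigma.fst).card := by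
      omega
    have hsub : (missSet k g).image Sigma.fst ⊆ X := by
      have := Finset.eq_of_subset_of_card_le (Finset.inter_subset_left (s₁ := (missSet k g).image Sigma.fst)
        (s₂ := X)) hinter_eq.ge
      intro a ha
      rw [← this] at ha
      exact (Finset.mem_inter.1 ha).2
    rw [image_fst_missSet_of_le_one g hle1] at hsub
    refine ⟨hnofull, hle1, hsub, ?_, hX3⟩
    rw [hXcard, card_missSet_of_le_one g hle1]
  · rintro ⟨hnofull, hle1, hsub, hXcard, hX3⟩
    have hfullE : fullSet k g = ∅ := (fullSet_eq_empty_iff g).2 hnofull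
    have hFu : (fullSet k g).card = 0 := by rw [hfullE, Finset.card_empty]
    have hMi := card_missSet_of_le_one g hle1
    rw [hfullE, Finset.image_empty, Finset.union_empty, image_fst_missSet_of_le_one g hle1, hunion, hXc,
      Finset.inter_eq_left.2 hsub]
    constructor
    · rw [min_eq_left hX3]; omega
    · have : min (4 - X.card + (typeM (hostType k g)).card) 3 = 3 := by
        rw [min_eq_right]; omega
      omega

/-! ## The up-set -/

variable (k)

/-- **The up-set pattern**: at most one missed ear on each host, the hosts with a missed ear inside `X`,
`#X ≥ #{hosts with a missed ear} + 1`, and at most two such hosts. -/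
def UpPat (X : Finset (Fin 4)) (g : Ear k → Finset Bool) : Prop :=
  (∀ j, hostMiss k g j ≤ 1) ∧ typeM (hostType k g) ⊆ X ∧ (typeM (hostType k g)).card + 1 ≤ X.card ∧
    (typeM (hostType k g)).card ≤ 2

variable {k}

/-- `hostMiss` only depends on which ears are missed. -/
lemma hostMiss_congr {g g' : Ear k → Finset Bool} (h : ∀ i, g i = ∅ ↔ g' i = ∅) (j : Fin 4) :
    hostMiss k g j = hostMiss k g' j := by
  unfold hostMiss
  congr 1
  apply Finset.filter_congr
  intro i _
  rw [h i]

/-- The host map is monotone: fewer missed ears in a larger set. -/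
lemma hostMiss_le_of_subset {A A' : Set (Gr k)} (h : A' ⊆ A) (j : Fin 4) :
    hostMiss k (patG k A) j ≤ hostMiss k (patG k A') j := by
  unfold hostMiss
  apply Finset.card_le_card
  intro i hi
  rw [Finset.mem_filter] at hi ⊢
  refine ⟨hi.1, hi.2.1, ?_⟩
  rw [Finset.eq_empty_iff_forall_notMem] at hi ⊢
  intro b hb
  exact hi.2.2 b (mem_patG.2 (h (mem_patG.1 hb)))

/-- One chosen edge of a nonempty pattern. -/
def pick (s : Finset Bool) : Finset Bool :=
  if true ∈ s then {true} else if false ∈ s then {false} else ∅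

/-- The chosen edge lies in the pattern. -/
lemma pick_subset (s : Finset Bool) : pick s ⊆ s := by
  unfold pick
  split_ifs with h1 h2
  · exact Finset.singleton_subset_iff.2 h1
  · exact Finset.singleton_subset_iff.2 h2
  · exact Finset.empty_subset _

/-- The chosen edge is empty iff the pattern is. -/
lemma pick_eq_empty_iff (s : Finset Bool) : pick s = ∅ ↔ s = ∅ := by
  unfold pick
  split_ifs with h1 h2
  · simp only [Finset.singleton_ne_empty, false_iff]
    exact Finset.ne_empty_of_mem h1
  · simp only [Finset.singleton_ne_empty, false_iff]
    exact Finset.ne_empty_of_mem h2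
  · simp only [true_iff]
    rw [Finset.eq_empty_iff_forall_notMem]
    intro b hb
    cases b
    · exact h2 hb
    · exact h1 hb

/-- The chosen edge is never the full pattern. -/
lemma pick_ne_univ (s : Finset Bool) : pick s ≠ Finset.univ := by
  unfold pick
  split_ifs <;> decide

/-- **THE UP-SET OF `C₄ + ears`** (tight layer `(K + 3, K + 1)`): `A` contains a bottom set iff its pattern is an
up-set pattern. -/
theorem exists_mem_Uq_subset_iff_ears (A : Set (Gr k)) :
    (∃ B ∈ PerFlat.Uq (ears k) (∑ j, k j + 3) (∑ j, k j + 1), (B : Set (Gr k)) ⊆ A) ↔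
      UpPat k (patX k A) (patG k A) := by
  classical
  constructor
  · rintro ⟨B, hB, hBA⟩
    rw [mem_Uq_ears] at hB
    obtain ⟨-, hle1, hsub, hcard, hX3⟩ := hB
    have hle1' : ∀ j, hostMiss k (patG k A) j ≤ 1 := fun j => (hostMiss_le_of_subset hBA j).trans (hle1 j)
    have hXsub : patX k (B : Set (Gr k)) ⊆ patX k A := by
      intro j hj; rw [mem_patX] at hj ⊢; exact hBA hj
    have hMsub : typeM (hostType k (patG k A)) ⊆ typeM (hostType k (patG k (B : Set (Gr k)))) := by
      rw [typeM_hostType, typeM_hostType]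
      intro j hj
      rw [Finset.mem_filter] at hj ⊢
      have := hostMiss_le_of_subset hBA j
      have := hle1 j
      exact ⟨Finset.mem_univ _, by omega⟩
    have hMcard := Finset.card_le_card hMsub
    have hXcard := Finset.card_le_card hXsub
    exact ⟨hle1', hMsub.trans (hsub.trans hXsub), by omega, by omega⟩
  · rintro ⟨hle1, hsub, hcard, hM2⟩
    obtain ⟨X, hMX, hXA, hXcard⟩ := Finset.exists_subsuperset_card_eq hsub (Nat.le_succ _) hcard
    set gB : Ear k → Finset Bool := fun i => pick (patG k A i) with hgB
    have hmissB : ∀ i, gB i = ∅ ↔ patG k A i = ∅ := fun i => pick_eq_empty_iff _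
    have hsubA : earsOf k X gB ⊆ A := by
      rintro (j | ⟨i, b⟩) hx
      · rw [inl_mem_earsOf] at hx
        exact mem_patX.1 (hXA hx)
      · rw [inr_mem_earsOf] at hx
        exact mem_patG.1 (pick_subset _ hx)
    refine ⟨(gr (ears k)).filter (fun x => x ∈ earsOf k X gB), ?_, ?_⟩
    · rw [mem_Uq_ears, coe_filter_mem_gr (ears k) (by simp only [ears_ground, Set.subset_univ]),
        patX_earsOf, patG_earsOf]
      have hM : typeM (hostType k gB) = typeM (hostType k (patG k A)) := by
        rw [typeM_hostType, typeM_hostType]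
        apply Finset.filter_congr
        intro j _
        rw [hostMiss_congr hmissB j]
      refine ⟨fun i => pick_ne_univ _, fun j => ?_, ?_, ?_, ?_⟩
      · rw [hostMiss_congr hmissB j]; exact hle1 j
      · rw [hM]; exact hMX
      · rw [hM, hXcard]
      · omega
    · rw [coe_filter_mem_gr (ears k) (by simp only [ears_ground, Set.subset_univ])]
      exact hsubA

end PercRepro.RankDist
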